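import Literature.AlgebraicGeometry.Resolution.LocalBlowup
import Literature.AlgebraicGeometry.Resolution.QuadraticTransforms
import Mathlib.RingTheory.LocalRing.RingHom.Basic
import HarnessLib

/-!
# Steer σ-residual, LOW half — D3a: the LOW tower read in ONE field (the residue field at the generic point of the
# critical surface) — MOVES: a curve step leaves the surface germ unchanged; a point step is a quadratic transform of it

OURS (campaign res-hironaka, rung L, slot W4.1, crux `Steer` stmt-ResolutionOfSingularities-16345; res-L0-w41-plan-1 RULINGS
18d/19c/20b «D3a LOW TOWER + MOVES», res-D-pv-012 AS res-L0-w41-stub-8; design memo `D/res-D-pv-012/D3a-SCOPE.md`; source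
res-L0-w41-idea-3 card 3 v3 / Sketch v3 §5). Theses-free, definition-free. AI-produced; weaker than expert review; nothing here
is a statement of the manuscript under review.

SETTING. `K` the function field, `Λ ≤ K` a LOCAL subring (in the application: the local ring `(R 0)_{P₀}` of the ambient germ at
the generic point of the critical surface `Σ₂ = V(P₀)`) with a ring map `φ : Λ → κ` to a field whose kernel consists of non-units
(the residue map).  For a member `R ≤ Λ` of the run we read `A := φ(R) ⊆ κ` — all `A`'s are subrings of ONE field `κ`.  A step
`R → R' = (R[S])_{centre of O}` STAYS inside `Λ` exactly when the new centre lies on the strict transform of `Σ₂` (C5′,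
`CriticalSurface.criticalSurfaceFollowed`); this is the hypothesis `R' ≤ Λ` below.

* `map_locAtCentre_closure_eq` — (M2) if the new generators `S` map into `φ(R)` (curve step: `eᵢ/w ↦ 0`), then
  `φ(R') = φ(R)`: the surface germ is UNCHANGED;
* `map_strictStep` — (M3) the radicand law `φ(s'²)·φ(x)² = φ(s²) − φ(G)²` along a strict step `s = x·s' + G`.
(M1) point step ⇒ quadratic transform of `φ(R)`, and the torsor tower `Y n ⊆ κ(√h̄₀)`, follow in the sibling files.
-/

noncomputable section

-- single-problem summit: the doubled namespace component `ResolutionOfSingularities` is forced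
set_option linter.dupNamespace false

namespace Summit.ResolutionOfSingularities.ResolutionOfSingularities.Theorems.SwitchingDichotomy.LowTower

open IsLocalRing
open Literature.AlgebraicGeometry.Resolution

variable {K κ : Type} [Field K] [Field κ]

/-! ## Images of subrings of `Λ` in the residue field -/

/-- Membership in the image `φ(R)` of a subring `R ≤ Λ` (as the subring `(R.comap Λ.subtype).map φ` of `κ`). [folklore] -/
theorem mem_map_comap_iff (Λ : Subring K) (φ : Λ →+* κ) (R : Subring K) (a : κ) :
    a ∈ (R.comap Λ.subtype).map φ ↔ ∃ r : Λ, (r : K) ∈ R ∧ φ r = a := by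
  simp [Subring.mem_map, Subring.mem_comap]

/-- A unit of `Λ` is not killed by a ring map whose kernel consists of non-units. [folklore] -/
theorem map_ne_zero_of_inv_mem (Λ : Subring K) (φ : Λ →+* κ) (hker : ∀ r : Λ, φ r = 0 → ¬ IsUnit r)
    {z : K} (hz : z ∈ Λ) (hzi : z⁻¹ ∈ Λ) (hz0 : z ≠ 0) : φ ⟨z, hz⟩ ≠ 0 := by
  intro h
  apply hker ⟨z, hz⟩ h
  exact (isUnit_subring_iff_inv_mem _).mpr ⟨hz0, hzi⟩

/-- `φ (y / z) * φ z = φ y` inside `Λ`. [folklore] -/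
theorem map_div_mul (Λ : Subring K) (φ : Λ →+* κ) {y z : K} (hy : y ∈ Λ) (hz : z ∈ Λ) (hyz : y / z ∈ Λ)
    (hz0 : z ≠ 0) : φ ⟨y / z, hyz⟩ * φ ⟨z, hz⟩ = φ ⟨y, hy⟩ := by
  rw [← map_mul]
  congr 1
  apply Subtype.ext
  change y / z * z = y
  exact div_mul_cancel₀ y hz0

/-! ## (M3) the radicand law along a strict step -/

/-- **(M3) Radicand law.** Along a strict step `s = x·s' + G` of the torsor generator (all of `s², s'², x, G` in `Λ`) the
residues satisfy `φ(s'²)·φ(x)² = φ(s²) − φ(G)²` in characteristic `2` — i.e. `h' = (h − Ḡ²)/x̄²` on the surface germ whenever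
`x̄ ≠ 0`. [folklore] [cite: NovacoskiSpivakovsky2014, §3.1] -/
theorem map_strictStep [CharP K 2] (Λ : Subring K) (φ : Λ →+* κ) {s s' x G : K}
    (hs : s ^ 2 ∈ Λ) (hs' : s' ^ 2 ∈ Λ) (hx : x ∈ Λ) (hG : G ∈ Λ) (hstep : s = x * s' + G) :
    φ ⟨s' ^ 2, hs'⟩ * φ ⟨x, hx⟩ ^ 2 = φ ⟨s ^ 2, hs⟩ - φ ⟨G, hG⟩ ^ 2 := by
  rw [← map_pow, ← map_pow, ← map_mul, ← map_sub]
  congr 1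
  apply Subtype.ext
  change s' ^ 2 * x ^ 2 = s ^ 2 - G ^ 2
  rw [hstep, add_pow_char]
  ring

/-! ## (M2) a step whose new generators die on the surface germ leaves it unchanged -/

/-- The image of a ring closure is generated by the images: if `φ(S) ⊆ φ(R)` for the finitely many new generators `S ⊆ Λ`
of a chart `R[S]`, then `φ(R[S]) = φ(R)` (as subrings of `κ`). [folklore] -/
theorem map_closure_union_eq (Λ : Subring K) (φ : Λ →+* κ) (R : Subring K) (hR : R ≤ Λ) (S : Set K) (hS : S ⊆ Λ)
    (hSR : ∀ z (hz : z ∈ S), φ ⟨z, hS hz⟩ ∈ (R.comap Λ.subtype).map φ)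
    (hC : Subring.closure ((R : Set K) ∪ S) ≤ Λ) :
    ((Subring.closure ((R : Set K) ∪ S)).comap Λ.subtype).map φ = (R.comap Λ.subtype).map φ := by
  -- every element of the closure (inside `Λ`) maps into `φ(R)`
  have key : ∀ z (hz : z ∈ Subring.closure ((R : Set K) ∪ S)),
      φ ⟨z, hC hz⟩ ∈ (R.comap Λ.subtype).map φ := by
    intro z hz
    induction hz using Subring.closure_induction with
    | mem z hz =>
      rcases hz with hz | hz
      · exact (mem_map_comap_iff Λ φ R _).mpr ⟨⟨z, hR hz⟩, hz, rfl⟩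
      · exact hSR z hz
    | zero =>
      have : (⟨(0 : K), hC (Subring.zero_mem _)⟩ : Λ) = 0 := rfl
      rw [this, map_zero]; exact Subring.zero_mem _
    | one =>
      have : (⟨(1 : K), hC (Subring.one_mem _)⟩ : Λ) = 1 := rfl
      rw [this, map_one]; exact Subring.one_mem _
    | add z w hz hw ihz ihw =>
      have : (⟨z + w, hC (Subring.add_mem _ hz hw)⟩ : Λ) = ⟨z, hC hz⟩ + ⟨w, hC hw⟩ := rfl
      rw [this, map_add]; exact Subring.add_mem _ ihz ihw
    | neg z hz ihz =>
      have : (⟨-z, hC (Subring.neg_mem _ hz)⟩ : Λ) = -⟨z, hC hz⟩ := rfl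
      rw [this, map_neg]; exact Subring.neg_mem _ ihz
    | mul z w hz hw ihz ihw =>
      have : (⟨z * w, hC (Subring.mul_mem _ hz hw)⟩ : Λ) = ⟨z, hC hz⟩ * ⟨w, hC hw⟩ := rfl
      rw [this, map_mul]; exact Subring.mul_mem _ ihz ihw
  refine le_antisymm ?_ ?_
  · intro a ha
    obtain ⟨r, hr, rfl⟩ := (mem_map_comap_iff Λ φ _ a).mp ha
    have := key (r : K) hr
    simpa using this
  · intro a ha
    obtain ⟨r, hr, rfl⟩ := (mem_map_comap_iff Λ φ R a).mp ha
    exact (mem_map_comap_iff Λ φ _ _).mpr ⟨r, Subring.subset_closure (Or.inl hr), rfl⟩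

/-- **(M2) A step whose new generators die on the surface germ leaves it unchanged.**  Let `R ≤ Λ` be a local member,
`S ⊆ Λ ∩ O` finitely many new generators with `φ(S) ⊆ φ(R)` (curve step of the LOW game: centre `(e₁′, e₂′, w)`, chart `w`,
`S = {e₁′/w, e₂′/w}`, `φ(eᵢ′/w) = 0`), and `R′ = (R[S])_{𝔪_O ∩ R[S]}` the next member, DOMINATING `R` and STILL INSIDE `Λ` (C5′: the
new centre lies on the strict transform of `Σ₂`).  Then `φ(R′) = φ(R)`: the surface germ `A` is unchanged.  (A unit `z₂` of `R′` used
as a denominator is congruent mod `ker φ` to some `c₂ ∈ R`, which is a unit of `R`: otherwise `z₂ = (z₂ − c₂) + c₂` is a sum of two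
non-units of the local ring `R′`.) [folklore] [cite: NovacoskiSpivakovsky2014, Def. 2.11] -/
theorem map_locAtCentre_closure_eq (Λ : Subring K) (φ : Λ →+* κ) (hker : ∀ r : Λ, φ r = 0 → ¬ IsUnit r)
    (O : ValuationSubring K) (R : Subring K) [IsLocalRing R] (hR : R ≤ Λ) (hRO : R ≤ O.toSubring)
    (S : Set K) (hS : S ⊆ Λ) (hSO : S ⊆ O)
    (hSR : ∀ z (hz : z ∈ S), φ ⟨z, hS hz⟩ ∈ (R.comap Λ.subtype).map φ)
    (hR' : locAtCentre (Subring.closure ((R : Set K) ∪ S)) O ≤ Λ)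
    (hdom : SubringDominates R (locAtCentre (Subring.closure ((R : Set K) ∪ S)) O)) :
    ((locAtCentre (Subring.closure ((R : Set K) ∪ S)) O).comap Λ.subtype).map φ = (R.comap Λ.subtype).map φ := by
  set C := Subring.closure ((R : Set K) ∪ S) with hCdef
  have hCO : C ≤ O.toSubring := Subring.closure_le.mpr (Set.union_subset hRO hSO)
  have hRC : R ≤ C := fun z hz => Subring.subset_closure (Or.inl hz)
  set R' := locAtCentre C O with hR'def
  have hCR' : C ≤ R' := le_locAtCentre C O
  have hC : C ≤ Λ := hCR'.trans hR'
  haveI : IsLocalRing R' := isLocalRing_locAtCentre hCO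
  have himg : (C.comap Λ.subtype).map φ = (R.comap Λ.subtype).map φ := map_closure_union_eq Λ φ R hR S hS hSR hC
  refine le_antisymm ?_ ?_
  swap
  · intro a ha
    obtain ⟨r, hr, rfl⟩ := (mem_map_comap_iff Λ φ R a).mp ha
    exact (mem_map_comap_iff Λ φ _ _).mpr ⟨r, hCR' (hRC hr), rfl⟩
  intro a ha
  obtain ⟨r, hr, rfl⟩ := (mem_map_comap_iff Λ φ _ a).mp ha
  obtain ⟨y, hy, z₂, hz₂, hv, hryz⟩ := (mem_locAtCentre_iff).mp hr
  have hz₂0 : z₂ ≠ 0 := ne_zero_of_valuation_eq_one hv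
  -- representatives in `R` of the residues of `y` and `z₂`
  have hyimg : φ ⟨y, hC hy⟩ ∈ (R.comap Λ.subtype).map φ := by
    rw [← himg]; exact (mem_map_comap_iff Λ φ _ _).mpr ⟨⟨y, hC hy⟩, hy, rfl⟩
  have hz₂img : φ ⟨z₂, hC hz₂⟩ ∈ (R.comap Λ.subtype).map φ := by
    rw [← himg]; exact (mem_map_comap_iff Λ φ _ _).mpr ⟨⟨z₂, hC hz₂⟩, hz₂, rfl⟩
  obtain ⟨c₁, hc₁R, hc₁⟩ := (mem_map_comap_iff Λ φ R _).mp hyimg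
  obtain ⟨c₂, hc₂R, hc₂⟩ := (mem_map_comap_iff Λ φ R _).mp hz₂img
  -- `z₂` is a unit of `R'`, hence of `Λ`
  have hz₂i : z₂⁻¹ ∈ R' := inv_mem_locAtCentre (hCR' hz₂) hv
  have hφz₂ : φ ⟨z₂, hC hz₂⟩ ≠ 0 := map_ne_zero_of_inv_mem Λ φ hker (hC hz₂) (hR' hz₂i) hz₂0
  -- `c₂` is a unit of `R`
  have hc₂unit : (c₂ : K)⁻¹ ∈ R := by
    by_contra hcon
    -- `c₂` is a non-unit of `R'` (domination) and `z₂ - c₂` is a non-unit of `R'` (it is killed by `φ`)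
    have h1 : ¬ IsUnit (⟨(c₂ : K), hCR' (hRC hc₂R)⟩ : R') := by
      intro hu
      rw [isUnit_subring_iff_inv_mem] at hu
      exact hcon (hdom.2 _ hc₂R hu.2)
    have h2 : ¬ IsUnit (⟨z₂ - c₂, R'.sub_mem (hCR' hz₂) (hCR' (hRC hc₂R))⟩ : R') := by
      intro hu
      rw [isUnit_subring_iff_inv_mem] at hu
      have hd : φ ⟨z₂ - c₂, Λ.sub_mem (hC hz₂) c₂.2⟩ = 0 := by
        have : (⟨z₂ - c₂, Λ.sub_mem (hC hz₂) c₂.2⟩ : Λ) = ⟨z₂, hC hz₂⟩ - c₂ := rfl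
        rw [this, map_sub, hc₂, sub_self]
      exact map_ne_zero_of_inv_mem Λ φ hker _ (hR' hu.2) hu.1 hd
    have h3 : IsUnit (⟨z₂, hCR' hz₂⟩ : R') :=
      (isUnit_subring_iff_inv_mem _).mpr ⟨hz₂0, hz₂i⟩
    have hsum : (⟨z₂, hCR' hz₂⟩ : R') = ⟨z₂ - c₂, R'.sub_mem (hCR' hz₂) (hCR' (hRC hc₂R))⟩ +
        ⟨(c₂ : K), hCR' (hRC hc₂R)⟩ := Subtype.ext (by simp)
    rw [hsum] at h3
    exact (IsLocalRing.nonunits_add h2 h1) h3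
  -- conclude: `φ r = φ c₁ · (φ c₂)⁻¹ = φ (c₁ c₂⁻¹)`
  have hφr : φ r * φ ⟨z₂, hC hz₂⟩ = φ ⟨y, hC hy⟩ := by
    have hrK : (r : K) = y / z₂ := hryz
    have : r = ⟨y / z₂, by rw [← hrK]; exact r.2⟩ := Subtype.ext hrK
    rw [this]
    exact map_div_mul Λ φ (hC hy) (hC hz₂) _ hz₂0
  refine (mem_map_comap_iff Λ φ R _).mpr ⟨c₁ * ⟨(c₂ : K)⁻¹, hR hc₂unit⟩, R.mul_mem hc₁R hc₂unit, ?_⟩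
  have hc₂0 : φ c₂ ≠ 0 := by rw [hc₂]; exact hφz₂
  have hinv : φ ⟨(c₂ : K)⁻¹, hR hc₂unit⟩ = (φ c₂)⁻¹ := by
    have hc₂K : (c₂ : K) ≠ 0 := by
      intro h0
      apply hc₂0
      have : c₂ = 0 := Subtype.ext h0
      rw [this, map_zero]
    have hm : c₂ * ⟨(c₂ : K)⁻¹, hR hc₂unit⟩ = 1 := Subtype.ext (mul_inv_cancel₀ hc₂K)
    have := congrArg φ hm
    rw [map_mul, map_one] at this
    exact (eq_inv_of_mul_eq_one_right this)
  rw [map_mul, hinv, hc₁, hc₂, ← div_eq_mul_inv]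
  exact (eq_div_of_mul_eq hφz₂ hφr).symm

/-! ## (M1) a point step is a quadratic transform of the surface germ -/

/-- The residue map restricted to a member `R ≤ Λ`, onto its image `φ(R) ⊆ κ`. [folklore] -/
theorem exists_surjective_restrict (Λ : Subring K) (φ : Λ →+* κ) (R : Subring K) (hR : R ≤ Λ) :
    ∃ ψ : R →+* (R.comap Λ.subtype).map φ, Function.Surjective ψ ∧
      ∀ r : R, ((ψ r : (R.comap Λ.subtype).map φ) : κ) = φ ⟨(r : K), hR r.2⟩ := by
  refine ⟨(φ.comp (Subring.inclusion hR)).codRestrict _ (fun r => ?_), ?_, fun r => rfl⟩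
  · exact (mem_map_comap_iff Λ φ R _).mpr ⟨⟨(r : K), hR r.2⟩, r.2, rfl⟩
  · rintro ⟨a, ha⟩
    obtain ⟨r, hr, rfl⟩ := (mem_map_comap_iff Λ φ R a).mp ha
    exact ⟨⟨(r : K), hr⟩, Subtype.ext rfl⟩

/-- The image `φ(R)` of a local member is a local ring. [folklore] -/
theorem isLocalRing_map (Λ : Subring K) (φ : Λ →+* κ) (R : Subring K) [IsLocalRing R] (hR : R ≤ Λ) :
    IsLocalRing ((R.comap Λ.subtype).map φ) := by
  obtain ⟨ψ, hψ, -⟩ := exists_surjective_restrict Λ φ R hR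
  exact IsLocalRing.of_surjective' ψ hψ

/-- Images of closures: if `φ(R) ⊆ T` and `φ(S) ⊆ T` for a subring `T ⊆ κ`, then `φ(R[S]) ⊆ T`. [folklore] -/
theorem map_mem_of_mem_closure (Λ : Subring K) (φ : Λ →+* κ) (R : Subring K) (hR : R ≤ Λ) (S : Set K) (hS : S ⊆ Λ)
    (T : Subring κ) (hRT : ∀ z (hz : z ∈ R), φ ⟨z, hR hz⟩ ∈ T) (hST : ∀ z (hz : z ∈ S), φ ⟨z, hS hz⟩ ∈ T)
    (hC : Subring.closure ((R : Set K) ∪ S) ≤ Λ) {z : K} (hz : z ∈ Subring.closure ((R : Set K) ∪ S)) :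
    φ ⟨z, hC hz⟩ ∈ T := by
  induction hz using Subring.closure_induction with
  | mem z hz =>
    rcases hz with hz | hz
    · exact hRT z hz
    · exact hST z hz
  | zero =>
    have : (⟨(0 : K), hC (Subring.zero_mem _)⟩ : Λ) = 0 := rfl
    rw [this, map_zero]; exact T.zero_mem
  | one =>
    have : (⟨(1 : K), hC (Subring.one_mem _)⟩ : Λ) = 1 := rfl
    rw [this, map_one]; exact T.one_mem
  | add z w hz hw ihz ihw =>
    have : (⟨z + w, hC (Subring.add_mem _ hz hw)⟩ : Λ) = ⟨z, hC hz⟩ + ⟨w, hC hw⟩ := rfl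
    rw [this, map_add]; exact T.add_mem ihz ihw
  | neg z hz ihz =>
    have : (⟨-z, hC (Subring.neg_mem _ hz)⟩ : Λ) = -⟨z, hC hz⟩ := rfl
    rw [this, map_neg]; exact T.neg_mem ihz
  | mul z w hz hw ihz ihw =>
    have : (⟨z * w, hC (Subring.mul_mem _ hz hw)⟩ : Λ) = ⟨z, hC hz⟩ * ⟨w, hC hw⟩ := rfl
    rw [this, map_mul]; exact T.mul_mem ihz ihw

/-- **(M1) A point step is a quadratic transform of the surface germ.**  Let `R ≤ Λ ∩ O` be a local member dominated by
the next member `R′ = (R[𝔪_R/x])_{𝔪_O ∩ R[𝔪_R/x]}` (a point step in the chart of `x ∈ 𝔪_R`), with `R′` STILL INSIDE `Λ` (C5′: the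
new centre lies on the strict transform of `Σ₂`) and `x̄ := φ(x) ≠ 0` (the chart sees `Σ₂`).  Then `φ(R′)` is a quadratic transform
of `φ(R)` inside the one field `κ`, with exceptional parameter `x̄`. [folklore] [cite: Cutkosky2014, §2.1] -/
theorem map_isQuadraticTransform (Λ : Subring K) (φ : Λ →+* κ) (hker : ∀ r : Λ, φ r = 0 → ¬ IsUnit r)
    (O : ValuationSubring K) (R : Subring K) [IsLocalRing R] (hR : R ≤ Λ) (hRO : R ≤ O.toSubring)
    (x : K) (hxR : x ∈ R) (hxm : (⟨x, hxR⟩ : R) ∈ maximalIdeal R) (hx0 : x ≠ 0)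
    (hdiv : ∀ y : R, y ∈ maximalIdeal R → (y : K) / x ∈ O)
    (hφx : φ ⟨x, hR hxR⟩ ≠ 0)
    (hR' : locAtCentre (blowupRing R x) O ≤ Λ)
    (hdom : SubringDominates R (locAtCentre (blowupRing R x) O)) :
    IsQuadraticTransform ((R.comap Λ.subtype).map φ) (((locAtCentre (blowupRing R x) O).comap Λ.subtype).map φ) := by
  classical
  set A := (R.comap Λ.subtype).map φ with hAdef
  set B := blowupRing R x with hBdef
  set R' := locAtCentre B O with hR'def
  set A' := (R'.comap Λ.subtype).map φ with hA'def
  have hBO : B ≤ O.toSubring := by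
    refine Subring.closure_le.mpr ?_
    rintro z (hz | ⟨y, hy, rfl⟩)
    · exact hRO hz
    · exact hdiv y hy
  have hBR' : B ≤ R' := le_locAtCentre B O
  have hRB : R ≤ B := le_blowupRing R x
  have hRR' : R ≤ R' := hRB.trans hBR'
  have hB : B ≤ Λ := hBR'.trans hR'
  haveI hR'loc : IsLocalRing R' := isLocalRing_locAtCentre hBO
  haveI hAloc : IsLocalRing A := isLocalRing_map Λ φ R hR
  haveI hA'loc : IsLocalRing A' := isLocalRing_map Λ φ R' hR'
  obtain ⟨ψ, hψs, hψ⟩ := exists_surjective_restrict Λ φ R hR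
  haveI := IsLocalHom.of_surjective ψ hψs
  -- the exceptional parameter downstairs
  let xA : A := ψ ⟨x, hxR⟩
  have hxA : (xA : κ) = φ ⟨x, hR hxR⟩ := hψ _
  have hxAm : xA ∈ maximalIdeal A := map_nonunit ψ _ hxm
  have hxA0 : xA ≠ 0 := fun h => hφx (by rw [← hxA, h]; rfl)
  have hAA' : A ≤ A' := by
    intro a ha
    obtain ⟨r, hr, rfl⟩ := (mem_map_comap_iff Λ φ R a).mp ha
    exact (mem_map_comap_iff Λ φ R' _).mpr ⟨r, hRR' hr, rfl⟩
  -- images of the chart elements `y / x`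
  have himg_div : ∀ (y : R) (hy : y ∈ maximalIdeal R),
      φ ⟨(y : K) / x, hB (div_mem_blowupRing x hy)⟩ = (ψ y : κ) / (xA : κ) := by
    intro y hy
    rw [eq_div_iff (by rw [hxA]; exact hφx), hxA, hψ]
    exact map_div_mul Λ φ (hR y.2) (hR hxR) _ hx0
  -- `φ(B) ⊆ blowupRing A xA`
  have hS : (fun y : R => (y : K) / x) '' (maximalIdeal R : Set R) ⊆ (Λ : Set K) := by
    rintro w ⟨y, hy, rfl⟩
    exact hB (div_mem_blowupRing x hy)
  have hBimg : ∀ {z : K} (hz : z ∈ B), φ ⟨z, hB hz⟩ ∈ blowupRing A (xA : κ) := by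
    intro z hz
    refine map_mem_of_mem_closure Λ φ R hR _ hS (blowupRing A (xA : κ)) (fun w hw => ?_) (fun w hw => ?_) hB hz
    · exact le_blowupRing A _ ((mem_map_comap_iff Λ φ R _).mpr ⟨⟨w, hR hw⟩, hw, rfl⟩)
    · obtain ⟨y, hy, rfl⟩ := hw
      rw [himg_div y hy]
      exact div_mem_blowupRing (xA : κ) (map_nonunit ψ y hy)
  refine ⟨hAloc, xA, hxAm, hxA0, hA'loc, ?_, ?_, ?_⟩
  · -- `blowupRing A xA ≤ A'`
    refine Subring.closure_le.mpr ?_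
    rintro a (ha | ⟨b, hb, rfl⟩)
    · exact hAA' ha
    · -- `b ∈ 𝔪_A` is `ψ y` with `y ∈ 𝔪_R`
      obtain ⟨y, rfl⟩ := hψs b
      have hy : y ∈ maximalIdeal R := by
        by_contra hy
        exact hb ((IsLocalRing.notMem_maximalIdeal.mp hy).map ψ)
      show ((ψ y : A) : κ) / (xA : κ) ∈ A'
      rw [← himg_div y hy]
      exact (mem_map_comap_iff Λ φ R' _).mpr ⟨_, hBR' (div_mem_blowupRing x hy), rfl⟩
  · -- fractions
    intro a ha
    obtain ⟨r, hr, rfl⟩ := (mem_map_comap_iff Λ φ R' a).mp ha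
    obtain ⟨y, hy, z₂, hz₂, hv, hryz⟩ := (mem_locAtCentre_iff).mp hr
    have hz₂0 : z₂ ≠ 0 := ne_zero_of_valuation_eq_one hv
    have hz₂i : z₂⁻¹ ∈ R' := inv_mem_locAtCentre (hBR' hz₂) hv
    have hφz₂ : φ ⟨z₂, hB hz₂⟩ ≠ 0 := map_ne_zero_of_inv_mem Λ φ hker (hB hz₂) (hR' hz₂i) hz₂0
    refine ⟨φ ⟨y, hB hy⟩, hBimg hy, φ ⟨z₂, hB hz₂⟩, hBimg hz₂, ?_, ?_⟩
    · -- `(φ z₂)⁻¹ = φ (z₂⁻¹) ∈ A'`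
      have hm : (⟨z₂, hB hz₂⟩ : Λ) * ⟨z₂⁻¹, hR' hz₂i⟩ = 1 := Subtype.ext (mul_inv_cancel₀ hz₂0)
      have h1 := congrArg φ hm
      rw [map_mul, map_one] at h1
      rw [← eq_inv_of_mul_eq_one_right h1]
      exact (mem_map_comap_iff Λ φ R' _).mpr ⟨_, hz₂i, rfl⟩
    · have hrK : (r : K) = y / z₂ := hryz
      have : r = ⟨y / z₂, by rw [← hrK]; exact r.2⟩ := Subtype.ext hrK
      rw [this, eq_div_iff hφz₂]
      exact map_div_mul Λ φ (hB hy) (hB hz₂) _ hz₂0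
  · -- domination
    refine ⟨hAA', fun a ha hai => ?_⟩
    obtain ⟨c, rfl⟩ := hψs ⟨a, ha⟩ |>.imp fun c hc => (congrArg Subtype.val hc)
    by_cases hc0 : (ψ c : κ) = 0
    · rw [hc0, inv_zero]; exact A.zero_mem
    by_cases hcu : IsUnit c
    · obtain ⟨hcK, hci⟩ := (isUnit_subring_iff_inv_mem c).mp hcu
      have hm : c * ⟨(c : K)⁻¹, hci⟩ = 1 := Subtype.ext (mul_inv_cancel₀ hcK)
      have h1 := congrArg (fun t : A => (t : κ)) (congrArg ψ hm)
      simp only [map_mul, map_one, Subring.coe_mul, Subring.coe_one] at h1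
      rw [← eq_inv_of_mul_eq_one_right h1]
      exact (ψ ⟨(c : K)⁻¹, hci⟩).2
    · -- `c` non-unit of `R`, hence of `R'`; its residue cannot be a unit of `A'`
      exfalso
      obtain ⟨r₁, hr₁, hr₁eq⟩ := (mem_map_comap_iff Λ φ R' _).mp hai
      have hcR' : ¬ IsUnit (⟨(c : K), hRR' c.2⟩ : R') := by
        intro hu
        rw [isUnit_subring_iff_inv_mem] at hu
        exact hcu ((isUnit_subring_iff_inv_mem c).mpr ⟨hu.1, hdom.2 _ c.2 hu.2⟩)
      -- `k := c * r₁ - 1 ∈ R'` is killed by `φ`, so it is a non-unit of `R'`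
      have hprod : φ (⟨(c : K), hR c.2⟩ * r₁) = 1 := by
        rw [map_mul, hr₁eq, ← hψ, mul_inv_cancel₀ hc0]
      have hkR' : (c : K) * r₁ - 1 ∈ R' := R'.sub_mem (R'.mul_mem (hRR' c.2) hr₁) R'.one_mem
      have hk : ¬ IsUnit (⟨(c : K) * r₁ - 1, hkR'⟩ : R') := by
        intro hu
        rw [isUnit_subring_iff_inv_mem] at hu
        have hφk : φ ⟨(c : K) * r₁ - 1, hR' hkR'⟩ = 0 := by
          have : (⟨(c : K) * r₁ - 1, hR' hkR'⟩ : Λ) = ⟨(c : K), hR c.2⟩ * r₁ - 1 := Subtype.ext rfl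
          rw [this, map_sub, map_one, hprod, sub_self]
        exact map_ne_zero_of_inv_mem Λ φ hker _ (hR' hu.2) hu.1 hφk
      have hcr : ¬ IsUnit (⟨(c : K) * r₁, R'.mul_mem (hRR' c.2) hr₁⟩ : R') := by
        have : (⟨(c : K) * r₁, R'.mul_mem (hRR' c.2) hr₁⟩ : R') = ⟨(c : K), hRR' c.2⟩ * ⟨r₁, hr₁⟩ := rfl
        rw [this]
        exact fun hu => hcR' (isUnit_of_mul_isUnit_left hu)
      have hone : (1 : R') = ⟨(c : K) * r₁, R'.mul_mem (hRR' c.2) hr₁⟩ - ⟨(c : K) * r₁ - 1, hkR'⟩ :=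
        Subtype.ext (by simp)
      have h1m : (1 : R') ∈ maximalIdeal R' := by
        rw [hone]
        exact Ideal.sub_mem _ ((IsLocalRing.mem_maximalIdeal _).mpr hcr) ((IsLocalRing.mem_maximalIdeal _).mpr hk)
      exact (IsLocalRing.maximalIdeal.isMaximal R').ne_top (Ideal.eq_top_of_isUnit_mem _ h1m isUnit_one)

end Summit.ResolutionOfSingularities.ResolutionOfSingularities.Theorems.SwitchingDichotomy.LowTower

end
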